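import Literature.NumberTheory.LFunctions.VAtypicalOrdinatesCount
import Literature.NumberTheory.LFunctions.TypicalOrdinateLadder
import Literature.NumberTheory.LFunctions.TypicalOrdinateCounting
import HarnessLib

/-!
# Balazard–de Roton 2008, Props. 18 and 20, in the shape consumed by Soundararajan's contour

Topic `Literature/NumberTheory/LFunctions`. Everything here is PROVED. The files
`VTypicalOrdinates.lean` (`isVTypical_of_RH` = BdR 2010 Prop. 9 / BR 2008 Prop. 18 with the 2010
threshold) and `VAtypicalOrdinatesCount.lean` (`card_atypical_le_of_RH` = BR 2008 Prop. 20) are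
stated for the predicate `IsVTypical`; the contour files (`SoundararajanContour*.lean`) consume
M. Balazard–A. de Roton's Propositions 18 and 20 through `Soundararajan.IsTypical` and the packaged
statements `TypicalLadder.Prop18With`, `TypicalCounting.Prop20With`. This file bridges the two:

* `isTypical_of_isVTypical` — `IsVTypical δ T V t → Soundararajan.IsTypical δ T V t`
  (same three conditions; the windows `]t'−h, t'+h]` are the windows `[u, u+2h]`, `u = t'−h`, and the
  two Dirichlet polynomials agree, `typicalSum_eq_typicalPrimeSum`);
* `prop18With_of_RH` — under RH, for `0 < δ ≤ ½` there is `T₀` with `Prop18With δ T₀`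
  (the 2010 threshold `½ + (½+δ)L₃/L₂` is below the 2008 threshold `½ + L₃/L₂` when `δ ≤ ½`);
* `prop20With_of_RH` — under RH, for `0 < δ ≤ 1` there is `T₀` with `Prop20With δ 1 12 T₀`.

## References

* [BalazardDeRoton2008] M. Balazard, A. de Roton, arXiv:0810.3587, Props. 18, 20. [cite: BalazardDeRoton2008, Props. 18 and 20]
* [BalazardDeRoton2010] M. Balazard, A. de Roton, arXiv:0812.1689, Prop. 9.
-/

noncomputable section

open Complex Real Filter Topology

namespace Literature.NumberTheory.LFunctions

open Soundararajan TypicalLadder TypicalCounting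

/-- The two renderings of the Dirichlet polynomial of condition (i) agree:
`Soundararajan.typicalSum (T^{1/V}) σ t = typicalPrimeSum T V σ t`. [folklore] -/
theorem typicalSum_eq_typicalPrimeSum (T V σ t : ℝ) :
    typicalSum (T ^ (1 / V)) σ t = typicalPrimeSum T V σ t := by
  unfold typicalSum typicalPrimeSum
  have e : Finset.Icc 0 ⌊T ^ (1 / V)⌋₊ = insert 0 (Finset.Icc 1 ⌊T ^ (1 / V)⌋₊) := by
    ext n; simp only [Finset.mem_Icc, Finset.mem_insert]; omega
  rw [e, Finset.sum_insert (by simp)]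
  simp only [Nat.cast_zero, ArithmeticFunction.map_zero, Complex.ofReal_zero, zero_div, zero_mul, zero_add]
  refine Finset.sum_congr rfl fun n _ ↦ ?_
  rw [Complex.cpow_neg]
  push_cast
  simp only [div_eq_mul_inv, mul_inv]
  ring

/-- **`IsVTypical → Soundararajan.IsTypical`** (same notion, two spellings). [cite: BalazardDeRoton2008, §1] -/
theorem isTypical_of_isVTypical {δ T V t : ℝ} (h : IsVTypical δ T V t) : IsTypical δ T V t := by
  refine ⟨h.ge, h.le, fun σ hσ ↦ ?_, fun t' h1 h2 ↦ ?_, fun t' h1 h2 ↦ ?_⟩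
  · rw [typicalSum_eq_typicalPrimeSum]; exact h.primeSum σ hσ
  · have e : t' - Real.pi * δ * V / Real.log T + 2 * π * δ * V / Real.log T =
        t' + Real.pi * δ * V / Real.log T := by ring
    have := h.zeros_delta (t' - Real.pi * δ * V / Real.log T) h1 (by rw [e]; exact h2)
    rwa [e] at this
  · have e : t' - Real.pi * V / (Real.log V * Real.log T) + 2 * π * V / (Real.log V * Real.log T) =
        t' + Real.pi * V / (Real.log V * Real.log T) := by ring
    have := h.zeros_logV (t' - Real.pi * V / (Real.log V * Real.log T)) h1 (by rw [e]; exact h2)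
    rwa [e] at this

/-- **Balazard–de Roton 2008, Prop. 18 (in the consumed shape), under RH, for `0 < δ ≤ ½`.**
[cite: BalazardDeRoton2008, Prop. 18] -/
theorem prop18With_of_RH (hRH : RiemannHypothesis) {δ : ℝ} (hδ0 : 0 < δ) (hδ : δ ≤ 1 / 2) :
    ∃ T₀ : ℝ, Prop18With δ T₀ := by
  obtain ⟨T₀, hT₀⟩ := isVTypical_of_RH hRH hδ0 (by linarith)
  -- also need `log log T > 0` and `log log log T ≥ 0` to compare the thresholds
  refine ⟨max T₀ (Real.exp (Real.exp (Real.exp 1))), fun T hT V hVl hVu t ht1 ht2 ↦ ?_⟩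
  have hTT₀ : T₀ ≤ T := (le_max_left _ _).trans hT
  have hTe : Real.exp (Real.exp (Real.exp 1)) ≤ T := (le_max_right _ _).trans hT
  have hT0 : 0 < T := (Real.exp_pos _).trans_le hTe
  have hL1 : Real.exp (Real.exp 1) ≤ Real.log T := by
    rw [← Real.log_exp (Real.exp (Real.exp 1))]; exact Real.log_le_log (Real.exp_pos _) hTe
  have hL1pos : 0 < Real.log T := (Real.exp_pos _).trans_le hL1
  have hL2 : Real.exp 1 ≤ Real.log (Real.log T) := by
    rw [← Real.log_exp (Real.exp 1)]; exact Real.log_le_log (Real.exp_pos _) hL1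
  have hL2pos : 0 < Real.log (Real.log T) := (Real.exp_pos _).trans_le hL2
  have hL3 : 0 ≤ Real.log (Real.log (Real.log T)) := by
    have h2e : (2 : ℝ) ≤ Real.exp 1 := by have := Real.add_one_le_exp (1 : ℝ); norm_num at this; linarith
    exact Real.log_nonneg (by linarith)
  refine isTypical_of_isVTypical (hT₀ T hTT₀ V ?_ ?_ t ht1 ht2)
  · -- `(½ + (½+δ) c/b) · a/b ≤ V` from `½ + c/b ≤ V b/a`
    have hcb : 0 ≤ Real.log (Real.log (Real.log T)) / Real.log (Real.log T) := by positivity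
    have h1 : (1 / 2 + (1 / 2 + δ) * (Real.log (Real.log (Real.log T)) / Real.log (Real.log T))) ≤
        V * Real.log (Real.log T) / Real.log T := by
      have : (1 / 2 + δ) * (Real.log (Real.log (Real.log T)) / Real.log (Real.log T)) ≤
          Real.log (Real.log (Real.log T)) / Real.log (Real.log T) := by
        have := mul_le_of_le_one_left hcb (by linarith : 1 / 2 + δ ≤ 1); linarith
      linarith
    calc (1 / 2 + (1 / 2 + δ) * (Real.log (Real.log (Real.log T)) / Real.log (Real.log T))) *
          (Real.log T / Real.log (Real.log T))
        ≤ V * Real.log (Real.log T) / Real.log T * (Real.log T / Real.log (Real.log T)) :=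
          mul_le_mul_of_nonneg_right h1 (by positivity)
      _ = V := by field_simp
  · -- `V ≤ a/b` from `V b/a ≤ 1`
    rw [le_div_iff₀ hL2pos]
    have := (div_le_one hL1pos).1 hVu
    linarith

/-- **Balazard–de Roton 2008, Prop. 20 (in the consumed shape), under RH, for `0 < δ ≤ 1`:**
`Prop20With δ 1 12 T₀` for some `T₀`. [cite: BalazardDeRoton2008, Prop. 20] -/
theorem prop20With_of_RH (hRH : RiemannHypothesis) {δ : ℝ} (hδ0 : 0 < δ) (hδ1 : δ ≤ 1) :
    ∃ T₀ : ℝ, Prop20With δ 1 12 T₀ := by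
  obtain ⟨T₀, hT₀⟩ := card_atypical_le_of_RH hRH hδ0 hδ1
  refine ⟨T₀, fun T hT V hVl hVu S hS hsep ↦ ?_⟩
  have h := hT₀ T hT V hVl hVu S (fun t ht ↦ ⟨(hS t ht).1, (hS t ht).2.1⟩) hsep
    (fun t ht hV ↦ (hS t ht).2.2 (isTypical_of_isVTypical hV))
  rw [one_mul]
  convert h using 2
  ring

end Literature.NumberTheory.LFunctions
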